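import Summits.CriticalPhenomena.CardyFormulaZ2.Theorems.CardyBondTriangularBondTriangularCardyDomainsGeometry
import HarnessLib

/-!
# Route CardyBondTriangular · crux `BondTriangularCardy` (stmt-CriticalPhenomena-4664), line `birth`,
# stub `stub_cofillGeometry`: the level-`ε` geometry of `G_δ⁺` with the cofill clauses

Helper of the stub `stub_cofillGeometry` (`Sig.stub_cofillGeometry`, reshape v5 of the line
`birth`): the model-free geometry of Bollobás–Riordan's Lemma 14 (*Percolation*, CUP 2006, Ch. 7,
p. 184; the landed `level_geometry` / `discreteDomains_geometry` of
`…CardyDomainsGeometry.lean`) re-run, for the "shorter, fatter" sign pattern `σp` (arcs `A₁`,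
`A₃` pushed out, `A₀`, `A₂` pulled in), with two more clauses at a fixed level `ε`:

* (cofill) every hexagon of `δ𝕋` whose centre is within `2δ` of `Ω`, at distance `≥ ε` from the
  corners and `≥ ε` from `A₀` and from `A₂`, is a site of the marked inner approximation `G` of
  the collar domain `D⁺ = collarRect R T σp h`;
* (co-far) every site of `G` at distance `≥ ε` from the corners is farther than `2δ` from `A₀`
  and from `A₂`.

The first is "compacta are swallowed" (`exists_forall_mem_innerApprox`, Bollobás–Riordan p. 199)
applied to the compact set of points within `c` of `Ω`, `ε`-far from the corners and from
`A₀ ∪ A₂`, which lies in the open `D⁺` (`cofill_subset_collarRect`: interior points are below the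
profile in tube coordinates, `tube_mem_collarRect`, `apply_mem_collarRect`; points off `Ω` are
within `c` of the far part of `A₁ ∪ A₃`, a compact subset of `D⁺`, thickened by
`IsCompact.exists_cthickening_subset_open`). The second: sites of the inner approximation are
`2δ`-deep (`closedBall_subset_of_mem_innerApprox`) while `A₀ ∪ A₂` minus the corners misses `D⁺`
(`tube_not_mem_collarRect`, profile `1 - h·bump < 1` there).

References: B. Bollobás, O. Riordan, *Percolation*, CUP 2006, Ch. 7, Lemma 14 p. 184, p. 186,
(28)–(29) p. 192, pp. 196–199.
-/

noncomputable section

namespace Summit.CriticalPhenomena.CardyFormulaZ2.Theorems.BondTriangularCardyLine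

open Set Filter Topology Metric
open Literature.Probability.Percolation Literature.Probability.RandomPlanarGeometry
open Literature.Probability.LatticeModels

/-- For a point off a nonempty open set, the frontier of the set is at most as far as the set
itself (every segment into the set crosses the frontier). -/
theorem infDist_frontier_le_infDist_of_not_mem_open {U : Set ℂ} (hU : IsOpen U) (hne : U.Nonempty)
    {z : ℂ} (hz : z ∉ U) : infDist z (frontier U) ≤ infDist z U := by
  refine (le_infDist hne).2 fun p hp => ?_
  obtain ⟨w, hw, hwf⟩ := exists_mem_segment_frontier hU hp (fun h => hz (h (right_mem_segment ℝ p z)))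
  have h1 := segment_subset_closedBall_right p z hw
  rw [mem_closedBall, dist_comm w z, dist_comm p z] at h1
  exact (infDist_le_dist_of_mem hwf).trans h1

/-- The pulled-in arcs of `σp` are `0` and `2`. -/
theorem σp_eq_neg_one_iff {i : Fin 4} : σp i = -1 ↔ i = 0 ∨ i = 2 := by
  fin_cases i <;> norm_num [σp] <;> decide

variable (R : ConformalRectangle) (T : R.toJordanDomain.TubeData)

/-- A point of the `i`-th arc which is not a corner has a parameter in the open `i`-th range. -/
theorem exists_Ioo_of_mem_arc_ne_pt {i : Fin 4} {a : ℂ} (ha : a ∈ R.arc i) (hne : ∀ j, a ≠ R.pt j) :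
    ∃ τ ∈ Ioo (R.mark i) (R.nextMark i), R.boundary τ = a := by
  obtain ⟨τ, hτ, rfl⟩ := ha
  refine ⟨τ, ⟨hτ.1.lt_of_ne fun h => hne i ?_, hτ.2.lt_of_ne fun h => hne (i + 1) ?_⟩, rfl⟩
  · rw [← h]; rfl
  · rw [h, R.boundary_nextMark]

/-- **Points of the pushed-out arcs `A₁`, `A₃` other than the corners lie in the collar domain
`D⁺`**: such a point is `tube 1 τ` with `τ` in an open range where the profile is
`1 + h·bump τ > 1` (`tube_mem_collarRect`). -/
theorem mem_collarRect_of_mem_arc_out {h : ℝ} (hh : 0 < h) (hh1 : h ≤ 1 / 2)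
    (hclose : ∀ t, dist (R.collarLoop T σp h t) (R.boundary t) < infDist T.z₀ (frontier R.carrier))
    {i : Fin 4} (hσi : σp i = 1) {a : ℂ} (ha : a ∈ R.arc i) (hne : ∀ j, a ≠ R.pt j) :
    a ∈ (R.collarRect T (MarkedDomain.abs_le_one_of_sign σp_sign) hh hh1).carrier := by
  obtain ⟨τ, hτ, rfl⟩ := exists_Ioo_of_mem_arc_ne_pt R ha hne
  have hp := R.profile_of_mem_Ioo σp h hτ
  rw [hσi, one_mul] at hp
  have h1 : (1 : ℝ) < R.profile σp h τ := by
    rw [hp.1]; have := mul_pos hh hp.2; linarith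
  have := R.tube_mem_collarRect T (MarkedDomain.abs_le_one_of_sign σp_sign) hh hh1 hclose zero_le_one h1
  rwa [T.tube_one] at this

/-- **Points of the pulled-in arcs `A₀`, `A₂` other than the corners lie outside the collar domain
`D⁺`**: such a point is `tube 1 τ` with `τ` in an open range where the profile is
`1 - h·bump τ < 1` (`tube_not_mem_collarRect`). -/
theorem not_mem_collarRect_of_mem_arc_in {h : ℝ} (hh : 0 < h) (hh1 : h ≤ 1 / 2)
    {i : Fin 4} (hσi : σp i = -1) {a : ℂ} (ha : a ∈ R.arc i) (hne : ∀ j, a ≠ R.pt j) :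
    a ∉ (R.collarRect T (MarkedDomain.abs_le_one_of_sign σp_sign) hh hh1).carrier := by
  obtain ⟨τ, hτ, rfl⟩ := exists_Ioo_of_mem_arc_ne_pt R ha hne
  have hp := R.profile_of_mem_Ioo σp h hτ
  rw [hσi] at hp
  have h1 : R.profile σp h τ < 1 := by
    rw [hp.1]; have := mul_pos hh hp.2; linarith
  have := R.tube_not_mem_collarRect T (MarkedDomain.abs_le_one_of_sign σp_sign) hh hh1 h1 one_lt_two
  rwa [T.tube_one] at this

/-- **The cofill region lies in `D⁺`.** If the tube is within `tol ≤ ε` of `∂Ω` at the levels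
`|s - 1| ≤ h` and the collar loop is closer to `∂Ω` than the depth of the centre, there is `c > 0`
such that every point within `c` of `Ω`, at distance `≥ ε` from the corners and `≥ ε` from `A₀`
and from `A₂`, lies in the collar domain `D⁺ = collarRect R T σp h`. Interior points: `Φ(u)` with
`‖u‖ < 1 - h` is inside (`apply_mem_collarRect`); with `1 - h ≤ ‖u‖ < 1` it is within `tol` of
`∂Ω(t)`, which therefore lies on a pushed-out arc, where the profile is `≥ 1 > ‖u‖`
(`tube_mem_collarRect`). Points off `Ω`: the nearest frontier point is within `c ≤ ε/2`, hence on
`A₁ ∪ A₃` and `ε/2`-far from the corners; that compact part of `A₁ ∪ A₃` lies in the open `D⁺`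
(`mem_collarRect_of_mem_arc_out`) together with a `c`-thickening (Bollobás–Riordan 2006, Ch. 7,
p. 186 and (28)–(29) p. 192). -/
theorem cofill_subset_collarRect {ε tol h : ℝ} (hε : 0 < ε) (hh : 0 < h) (hh1 : h ≤ 1 / 2)
    (hdist : ∀ s t, 1 - h ≤ s → s ≤ 1 + h → dist (T.tube s t) (R.boundary t) < tol) (htolε : tol ≤ ε)
    (hclose : ∀ t, dist (R.collarLoop T σp h t) (R.boundary t) < infDist T.z₀ (frontier R.carrier)) :
    ∃ c > 0, ∀ z : ℂ, infDist z R.carrier ≤ c → (∀ j, ε ≤ dist z (R.pt j)) →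
      ε ≤ infDist z (R.arc 0) → ε ≤ infDist z (R.arc 2) →
      z ∈ (R.collarRect T (MarkedDomain.abs_le_one_of_sign σp_sign) hh hh1).carrier := by
  have hσ := MarkedDomain.abs_le_one_of_sign σp_sign
  -- the far part of the pushed-out arcs is a compact subset of the open `D⁺`
  set A : Set ℂ := (R.arc 1 ∪ R.arc 3) ∩ {a | ∀ j, ε / 2 ≤ dist a (R.pt j)} with hA
  have hAcl : IsClosed {a : ℂ | ∀ j, ε / 2 ≤ dist a (R.pt j)} := by
    rw [setOf_forall]
    exact isClosed_iInter fun j => isClosed_le continuous_const (continuous_id.dist continuous_const)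
  have hAc : IsCompact A := ((R.isCompact_arc 1).union (R.isCompact_arc 3)).inter_right hAcl
  have hAD : A ⊆ (R.collarRect T hσ hh hh1).carrier := by
    rintro a ⟨ha, hfar⟩
    have hne : ∀ j, a ≠ R.pt j := fun j hj => by
      have := hfar j; rw [hj, dist_self] at this; linarith
    rcases ha with ha | ha
    · exact mem_collarRect_of_mem_arc_out R T hh hh1 hclose (by simp [σp]) ha hne
    · exact mem_collarRect_of_mem_arc_out R T hh hh1 hclose (by simp [σp]) ha hne
  obtain ⟨r, hr, hrD⟩ := hAc.exists_cthickening_subset_open (R.collarRect T hσ hh hh1).isOpen hAD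
  refine ⟨min r (ε / 2), lt_min hr (half_pos hε), fun z hzc hfar h0 h2 => ?_⟩
  have hcr : min r (ε / 2) ≤ r := min_le_left _ _
  have hcε : min r (ε / 2) ≤ ε / 2 := min_le_right _ _
  by_cases hzΩ : z ∈ R.carrier
  · -- interior points: chart coordinates `z = Φ u`, `‖u‖ < 1`
    obtain ⟨u, hu, rfl⟩ := T.Ci.bijOn_ball.surjOn hzΩ
    have hu1 : ‖u‖ < 1 := mem_ball_zero_iff.1 hu
    by_cases hdeep : ‖u‖ < 1 - h
    · exact R.apply_mem_collarRect T hσ hh hh1 hclose hdeep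
    push Not at hdeep
    have hu0 : u ≠ 0 := by
      rintro rfl; rw [norm_zero] at hdeep; linarith
    have hn : 0 < ‖u‖ := norm_pos_iff.2 hu0
    -- `u = ‖u‖ β t`
    set v : ℂ := ((‖u‖⁻¹ : ℝ) : ℂ) * u with hv
    have hv1 : ‖v‖ = 1 := by
      rw [hv, norm_mul, Complex.norm_real, Real.norm_eq_abs, abs_of_pos (inv_pos.2 hn), inv_mul_cancel₀ hn.ne']
    obtain ⟨t, ht⟩ : ∃ t, T.Ci.β t = v := by
      have hfr : T.Ci.Φ v ∈ frontier R.carrier := T.Ci.apply_mem_frontier hv1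
      rw [← R.range_boundary] at hfr
      obtain ⟨t, ht⟩ := hfr
      refine ⟨t, T.Ci.injOn (mem_closedBall_zero_iff.2 (T.Ci.norm_β t).le) (mem_closedBall_zero_iff.2 hv1.le) ?_⟩
      rw [T.Ci.apply_β]; exact ht
    have hu' : u = ((‖u‖ : ℝ) : ℂ) * T.Ci.β t := by
      rw [ht, hv, ← mul_assoc, ← Complex.ofReal_mul, mul_inv_cancel₀ hn.ne', Complex.ofReal_one, one_mul]
    have hzt : T.Ci.Φ u = T.tube ‖u‖ t := by rw [T.tube_of_le_one hu1.le, ← hu']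
    have hzq : dist (T.Ci.Φ u) (R.boundary t) < tol := by
      rw [hzt]; exact hdist ‖u‖ t hdeep (by linarith)
    obtain ⟨i, τ, hτ, hbτ, -, hpτ, -⟩ := R.exists_window T σp h t
    rcases σp_sign i with hσi | hσi
    · -- over a pushed-out arc: below the profile
      have hpi := R.profile_of_mem_Icc σp h (i := i) hτ
      rw [hσi, one_mul] at hpi
      have hlt : ‖u‖ < R.profile σp h t := by
        rw [← hpτ, hpi]
        have := mul_nonneg hh.le (MarkedDomain.bump_nonneg (R.mark i) (R.nextMark i) τ)
        linarith
      rw [hzt]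
      exact R.tube_mem_collarRect T hσ hh hh1 hclose hn.le hlt
    · -- over a pulled-in arc: too close to `A₀ ∪ A₂`
      exfalso
      have hq : R.boundary t ∈ R.arc i := ⟨τ, hτ, hbτ⟩
      have hlt : infDist (T.Ci.Φ u) (R.arc i) < ε :=
        (infDist_le_dist_of_mem hq).trans_lt (hzq.trans_le htolε)
      rcases σp_eq_neg_one_iff.1 hσi with rfl | rfl
      · linarith
      · linarith
  · -- points off `Ω`: within `c` of the far part of a pushed-out arc
    have hfr : infDist z (frontier R.carrier) ≤ min r (ε / 2) :=
      (infDist_frontier_le_infDist_of_not_mem_open R.isOpen R.nonempty hzΩ).trans hzc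
    obtain ⟨a, ha, hda⟩ := R.toJordanDomain.isCompact_frontier.exists_infDist_eq_dist
      R.toJordanDomain.frontier_nonempty z
    rw [hda] at hfr
    rw [← R.range_boundary] at ha
    obtain ⟨t, rfl⟩ := ha
    obtain ⟨i, τ, hτ, hbτ, -, -, -⟩ := R.exists_window T σp h t
    have hq : R.boundary t ∈ R.arc i := ⟨τ, hτ, hbτ⟩
    rcases σp_sign i with hσi | hσi
    · refine hrD (mem_cthickening_of_dist_le z (R.boundary t) r A ⟨?_, fun j => ?_⟩ (hfr.trans hcr))
      · rcases σp_eq_one_iff.1 hσi with rfl | rfl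
        · exact Or.inl hq
        · exact Or.inr hq
      · have := dist_triangle z (R.boundary t) (R.pt j)
        linarith [hfar j]
    · exfalso
      have hlt : infDist z (R.arc i) < ε := (infDist_le_dist_of_mem hq).trans_lt (by linarith)
      rcases σp_eq_neg_one_iff.1 hσi with rfl | rfl
      · linarith
      · linarith

/-- **The level-`ε` geometry of `G⁺` with the cofill clauses.** For a conformal rectangle `R` with
boundary of index `1`, tube data `T` and a level `ε > 0`: a width `h ≤ ε` of the "shorter, fatter"
collar domain `D⁺ = collarRect R T σp h` (containing the centre) and `δ₀ > 0` such that for every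
`δ < δ₀` the marked inner approximation `G` of `D⁺` of `level_geometry` has all the level-`ε`
properties of `level_geometry` (arcs mutually within `2ε`; sites off `Ω` within `ε` of a
pushed-out arc; sites in `Ω` at distance `≥ ε` from the corners farther than `δ` from `A₀ ∪ A₂`;
far sites of the discrete arcs `1`, `3` off `Ω`; fill of `Φ(B̄(0, 1 - 2ε))`; `2ε`-dense faces) and
moreover: (cofill) every site with mesh point within `2δ` of `Ω`, at distance `≥ ε` from the
corners and `≥ ε` from `A₀` and from `A₂`, is a site of `G` (the cofill region is a compact subset
of `D⁺`, `cofill_subset_collarRect`, swallowed by the inner approximation,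
`exists_forall_mem_innerApprox`); (co-far) every site of `G` at distance `≥ ε` from the corners
is farther than `2δ` from `A₀` and from `A₂` (its closed `2δ`-ball lies in `D⁺`,
`closedBall_subset_of_mem_innerApprox`, while `A₀ ∪ A₂` minus the corners misses `D⁺`,
`not_mem_collarRect_of_mem_arc_in`). The width is taken below the tube threshold of
`exists_dist_tube_lt` at tolerance `min ε (d(z₀, ∂Ω)/2)` by running `level_geometry` at the level
`min ε h₁` (Bollobás–Riordan 2006, Ch. 7, Lemma 14 p. 184, (28)–(29) p. 192, pp. 196–199). -/
theorem level_geometry_cofill :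
    ∀ (R : Literature.Probability.RandomPlanarGeometry.ConformalRectangle) (T : R.toJordanDomain.TubeData),
      (∀ z ∈ R.carrier, R.index z = 1) → ∀ (ε : ℝ), 0 < ε →
      ∃ (h : ℝ) (hh : 0 < h) (hh1 : h ≤ 1 / 2), h ≤ ε ∧
        T.z₀ ∈ (R.collarRect T (Literature.Probability.RandomPlanarGeometry.MarkedDomain.abs_le_one_of_sign
          Literature.Probability.Percolation.σp_sign) hh hh1).carrier ∧
        ∃ δ₀ > (0 : ℝ), ∀ (δ : ℝ) (hδ : 0 < δ), δ < δ₀ →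
          ∃ hc₀ : Literature.Probability.Percolation.baseSite T.z₀ δ ∈ Literature.Probability.Percolation.innerCoarse
              (R.collarRect T (Literature.Probability.RandomPlanarGeometry.MarkedDomain.abs_le_one_of_sign
                Literature.Probability.Percolation.σp_sign) hh hh1).carrier δ,
          ∃ G : Literature.Probability.Percolation.TriMarkedDomain 4,
            G.verts = (Literature.Probability.Percolation.innerApprox
              (R.collarRect T (Literature.Probability.RandomPlanarGeometry.MarkedDomain.abs_le_one_of_sign
                Literature.Probability.Percolation.σp_sign) hh hh1).toJordanDomain hδ hc₀).verts ∧
            (∀ i : Fin 4, (∀ y ∈ G.arc i, ∃ z ∈ R.arc i, dist (Literature.Probability.LatticeModels.triMeshPoint δ y) z < 2 * ε) ∧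
              ∀ z ∈ R.arc i, ∃ y ∈ G.arc i, dist (Literature.Probability.LatticeModels.triMeshPoint δ y) z < 2 * ε) ∧
            (∀ x ∈ G.verts, Literature.Probability.LatticeModels.triMeshPoint δ x ∉ R.carrier →
              ∃ i : Fin 4, Literature.Probability.Percolation.σp i = 1 ∧
                Metric.infDist (Literature.Probability.LatticeModels.triMeshPoint δ x) (R.arc i) ≤ ε) ∧
            (∀ x ∈ G.verts, Literature.Probability.LatticeModels.triMeshPoint δ x ∈ R.carrier →
              (∀ i : Fin 4, ε ≤ dist (Literature.Probability.LatticeModels.triMeshPoint δ x) (R.pt i)) →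
              ∀ j : Fin 4, Literature.Probability.Percolation.σp j = -1 →
                δ < Metric.infDist (Literature.Probability.LatticeModels.triMeshPoint δ x) (R.arc j)) ∧
            (∀ i : Fin 4, Literature.Probability.Percolation.σp i = 1 → ∀ u ∈ G.arc i,
              (∀ k : Fin 4, ε ≤ dist (Literature.Probability.LatticeModels.triMeshPoint δ u) (R.pt k)) →
              Literature.Probability.LatticeModels.triMeshPoint δ u ∉ R.carrier) ∧
            (∀ x : Literature.Probability.LatticeModels.Site 2,
              Literature.Probability.LatticeModels.triMeshPoint δ x ∈ T.Ci.Φ '' Metric.closedBall (0 : ℂ) (1 - 2 * ε) → x ∈ G.verts) ∧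
            (∀ z ∈ closure R.carrier, ∃ w ∈ G.faces, dist z ((δ : ℂ) * Literature.Probability.LatticeModels.hexCenter w) < 2 * ε) ∧
            (∀ x : Literature.Probability.LatticeModels.Site 2,
              Metric.infDist (Literature.Probability.LatticeModels.triMeshPoint δ x) R.carrier ≤ 2 * δ →
              (∀ j : Fin 4, ε ≤ dist (Literature.Probability.LatticeModels.triMeshPoint δ x) (R.pt j)) →
              ε ≤ Metric.infDist (Literature.Probability.LatticeModels.triMeshPoint δ x) (R.arc 0) →
              ε ≤ Metric.infDist (Literature.Probability.LatticeModels.triMeshPoint δ x) (R.arc 2) → x ∈ G.verts) ∧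
            (∀ x ∈ G.verts, (∀ j : Fin 4, ε ≤ dist (Literature.Probability.LatticeModels.triMeshPoint δ x) (R.pt j)) →
              2 * δ < Metric.infDist (Literature.Probability.LatticeModels.triMeshPoint δ x) (R.arc 0) ∧
                2 * δ < Metric.infDist (Literature.Probability.LatticeModels.triMeshPoint δ x) (R.arc 2)) := by
  intro R T hR1 ε hε
  classical
  have hσ := MarkedDomain.abs_le_one_of_sign σp_sign
  -- the tube tolerance `min ε (d₀/2)` and its width threshold `h₁`
  have hd₀ := R.toJordanDomain.infDist_frontier_pos T.hz₀
  obtain ⟨h₁, hh₁, -, hdist₁⟩ := T.exists_dist_tube_lt (ε := min ε (infDist T.z₀ (frontier R.carrier) / 2)) (by positivity)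
  -- the level-`min ε h₁` geometry
  obtain ⟨h, hh, hh1, hhε', hz₀, δ₀, hδ₀, hlev⟩ := level_geometry R T σp_sign hR1 (lt_min hε hh₁)
  have hε'ε : min ε h₁ ≤ ε := min_le_left _ _
  have hhε : h ≤ ε := hhε'.trans hε'ε
  have hhh₁ : h ≤ h₁ := hhε'.trans (min_le_right _ _)
  have hdist : ∀ s t, 1 - h ≤ s → s ≤ 1 + h →
      dist (T.tube s t) (R.boundary t) < min ε (infDist T.z₀ (frontier R.carrier) / 2) :=
    fun s t hs hs' => hdist₁ s t (by linarith) (by linarith)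
  have hclose : ∀ t, dist (R.collarLoop T σp h t) (R.boundary t) < infDist T.z₀ (frontier R.carrier) := fun t => by
    have hp := R.profile_mem hσ hh t
    exact ((hdist _ _ (by linarith [hp.1]) (by linarith [hp.2])).trans_le (min_le_right _ _)).trans_le (by linarith)
  -- the cofill compactum `K ⊆ D⁺`
  obtain ⟨c, hc, hK⟩ := cofill_subset_collarRect R T hε hh hh1 hdist (min_le_left _ _) hclose
  set K : Set ℂ := {z | infDist z R.carrier ≤ c} ∩ ({z | ∀ j, ε ≤ dist z (R.pt j)} ∩
    ({z | ε ≤ infDist z (R.arc 0)} ∩ {z | ε ≤ infDist z (R.arc 2)})) with hKdef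
  have hKc : IsCompact K := by
    refine Metric.isCompact_of_isClosed_isBounded ?_ ?_
    · refine (isClosed_le (continuous_infDist_pt _) continuous_const).inter (IsClosed.inter ?_
        ((isClosed_le continuous_const (continuous_infDist_pt _)).inter
          (isClosed_le continuous_const (continuous_infDist_pt _))))
      rw [setOf_forall]
      exact isClosed_iInter fun j => isClosed_le continuous_const (continuous_id.dist continuous_const)
    · obtain ⟨Rad, hRad⟩ := R.isBounded.subset_closedBall 0
      refine (isBounded_closedBall (x := (0 : ℂ)) (r := Rad + (c + 1))).subset ?_
      rintro z ⟨(hz : infDist z R.carrier ≤ c), -⟩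
      obtain ⟨y, hy, hzy⟩ := (infDist_lt_iff R.nonempty).1 (hz.trans_lt (lt_add_one c))
      have hy0 := hRad hy
      rw [mem_closedBall] at hy0 ⊢
      linarith [dist_triangle z y 0]
  have hKD : K ⊆ (R.collarRect T hσ hh hh1).carrier := fun z hz => hK z hz.1 hz.2.1 hz.2.2.1 hz.2.2.2
  obtain ⟨δB, hδB, hswallow⟩ := exists_forall_mem_innerApprox (R.collarRect T hσ hh hh1).toJordanDomain hz₀ hKc hKD
  -- the threshold
  refine ⟨h, hh, hh1, hhε, hz₀, min δ₀ (min δB (min (c / 2) (ε / 2))), by positivity, fun δ hδ hδlt => ?_⟩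
  have hδ₀' : δ < δ₀ := hδlt.trans_le (min_le_left _ _)
  have hδB' : δ < δB := hδlt.trans_le ((min_le_right _ _).trans (min_le_left _ _))
  have hδc : δ < c / 2 := hδlt.trans_le ((min_le_right _ _).trans ((min_le_right _ _).trans (min_le_left _ _)))
  have hδε : δ < ε / 2 := hδlt.trans_le ((min_le_right _ _).trans ((min_le_right _ _).trans (min_le_right _ _)))
  obtain ⟨hc₀, G, hGv, harcs, H1, H2, H3, hfill, hdense⟩ := hlev δ hδ hδ₀'
  obtain ⟨_, hKv⟩ := hswallow δ hδ hδB'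
  refine ⟨hc₀, G, hGv, fun i => ⟨fun y hy => ?_, fun z hz => ?_⟩, fun x hx hxΩ => ?_,
    fun x hx hxΩ hfar j hσj => H2 x hx hxΩ (fun i => hε'ε.trans (hfar i)) j hσj,
    fun i hσi u hu hfar => H3 i hσi u hu (fun k => hε'ε.trans (hfar k)), fun x hx => ?_, fun z hz => ?_,
    fun x hxc hfar h0 h2 => ?_, fun x hx hfar => ?_⟩
  · obtain ⟨z, hz, hd⟩ := (harcs i).1 y hy
    exact ⟨z, hz, hd.trans_le (by linarith)⟩
  · obtain ⟨y, hy, hd⟩ := (harcs i).2 z hz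
    exact ⟨y, hy, hd.trans_le (by linarith)⟩
  · obtain ⟨i, hσi, hd⟩ := H1 x hx hxΩ
    exact ⟨i, hσi, hd.trans hε'ε⟩
  · refine hfill x ?_
    obtain ⟨u, hu, hux⟩ := hx
    exact ⟨u, closedBall_subset_closedBall (by linarith) hu, hux⟩
  · obtain ⟨w, hw, hd⟩ := hdense z hz
    exact ⟨w, hw, hd.trans_le (by linarith)⟩
  · -- (cofill): the mesh point lies in the swallowed compactum `K`
    rw [hGv]
    exact hKv x ⟨hxc.trans (by linarith), hfar, h0, h2⟩
  · -- (co-far): the closed `2δ`-ball about a site lies in `D⁺`, which misses `A₀ ∪ A₂` off the corners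
    have hxD : closedBall (triMeshPoint δ x) (2 * δ) ⊆ (R.collarRect T hσ hh hh1).carrier := by
      rw [hGv] at hx
      exact closedBall_subset_of_mem_innerApprox _ hδ hc₀ hx
    have key : ∀ i, σp i = -1 → 2 * δ < infDist (triMeshPoint δ x) (R.arc i) := by
      intro i hσi
      by_contra hle
      push Not at hle
      obtain ⟨a, ha, hda⟩ := (R.isCompact_arc i).exists_infDist_eq_dist ⟨_, R.pt_mem_arc_self i⟩ (triMeshPoint δ x)
      have haD : a ∈ (R.collarRect T hσ hh hh1).carrier :=
        hxD (mem_closedBall.2 (by rw [dist_comm, ← hda]; exact hle))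
      have hne : ∀ j, a ≠ R.pt j := fun j hj => by
        have := hfar j
        rw [← hj, ← hda] at this
        linarith
      exact not_mem_collarRect_of_mem_arc_in R T hh hh1 hσi ha hne haD
    exact ⟨key 0 (by simp [σp]), key 2 (by simp [σp])⟩

end Summit.CriticalPhenomena.CardyFormulaZ2.Theorems.BondTriangularCardyLine

end
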